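import Mathlib.Algebra.Lie.UniversalEnveloping
import Literature.NumberTheory.Automorphic.AutomorphicRepLieActionGL
import HarnessLib

/-!
# The enveloping algebra acting on an automorphic representation of `GL_n(𝔸_K)`:
# generation by `𝔤`, compatibility with `W → W / W'`, restriction to sub-data, central elements

Topic `NumberTheory/Automorphic`; theorems only. For an automorphic representation datum
`π = W / W'` of `GL_n(𝔸_K)` (Borel–Jacquet 1979, 4.6; `AutomorphicRepData (AutomorphyDatum.gl n K hcpt)`)
the Lie algebra `𝔤 = 𝔤𝔩_n(K_∞)` acts on `W` (`π.lieRepW`, by Lie derivatives) and on `W / W'`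
(`π.lieRep`; `AutomorphicRepLieActionGL`), hence the real enveloping algebra `U(𝔥)` of any real Lie
algebra `𝔥` mapping to `𝔤` (`f : 𝔥 →ₗ⁅ℝ⁆ 𝔤`; e.g. a place factor `𝔤𝔩ₙ(K_w) ↪ 𝔤`) acts on both
through `UniversalEnvelopingAlgebra.lift`. Elementary facts used when comparing infinitesimal
characters of different data (clean models, twists):

* `envelope_subalgebra_eq_top_of_forall_ι_mem`, `envelope_induction` — a subalgebra of `U(𝔥)`
  containing `ι(𝔥)` is everything; the resulting induction principle (generators, scalars, sums,
  products). (Mathlib's `UniversalEnvelopingAlgebra` has `lift`/`hom_ext` but no induction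
  principle; this is `hom_ext` applied to the inclusion of the subalgebra.)
* `envelope_ι_mem_center_of_forall_lie_eq_zero` — a central element of `𝔥` is central in `U(𝔥)`
  (for any real or general Lie algebra; the tree's `ι_mem_center_of_forall_lie_eq_zero` of
  `ArchPullbackCalculus` is the case `𝔥 = H.lie` of a linear real group).
* `AutomorphicRepData.lift_lieRep_comp_mkQ` — **`U(𝔥)` acts on `W / W'` through its action on
  `W`**: `(lift (π.lieRep ∘ f) u) [w] = [(lift (π.lieRepW ∘ f) u) w]`.
* `AutomorphicRepData.coe_lift_lieRepW_of_le` — **restriction**: if `π₀.W ≤ π.W` then `U(𝔥)` acts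
  on `π₀.W` by the same operators on functions as on `π.W` (both are iterated Lie derivatives).
* `AutomorphicRepData.commute_lieRepW_of_forall_lie_eq_zero` — the operator of a central `Z ∈ 𝔤`
  on `W` commutes with the whole action of `U(𝔥)` (e.g. `Z = 1`, the generator of the split
  component `A_G`, `lie_one_eq_zero`).

## References

* A. Borel, H. Jacquet, Corvallis 1979, §1.5, 4.6. [BorelJacquet1979]
* J. Dixmier, *Enveloping Algebras* (1996), 2.1 (generation of `U(𝔤)` by `𝔤`). [folklore]
-/

-- Mathlib idiom (Mathlib/Algebra/Lie/OfAssociative.lean): the commutator bracket on associative algebras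
attribute [local instance 100] LieRing.ofAssociativeRing

noncomputable section

open scoped MatrixGroups Matrix Classical
open NumberField NumberField.mixedEmbedding IsDedekindDomain UniversalEnvelopingAlgebra

namespace Literature.NumberTheory.Automorphic

/-! ### Generation of `U(𝔥)` by `𝔥` -/

section Envelope

variable {R : Type*} [CommRing R] {L : Type*} [LieRing L] [LieAlgebra R L]

/-- **A subalgebra of `U(𝔥)` containing the generators `ι(𝔥)` is all of `U(𝔥)`**: lift the Lie
homomorphism `𝔥 → S` and compose with the inclusion; by the universal property the composite is
the identity. Dixmier, 2.1. [folklore] -/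
theorem envelope_subalgebra_eq_top_of_forall_ι_mem (S : Subalgebra R (UniversalEnvelopingAlgebra R L))
    (h : ∀ X : L, ι R X ∈ S) : S = ⊤ := by
  let f : L →ₗ⁅R⁆ S :=
    { toFun := fun X => ⟨ι R X, h X⟩
      map_add' := fun X Y => Subtype.ext (by simp)
      map_smul' := fun r X => Subtype.ext (by simp)
      map_lie' := fun {X Y} => Subtype.ext (by
        rw [LieRing.of_associative_ring_bracket]
        simp only [Subalgebra.coe_sub, Subalgebra.coe_mul, LieHom.map_lie]
        rw [LieRing.of_associative_ring_bracket]) }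
  have hg : S.val.comp (lift R f) = AlgHom.id R _ := by
    apply UniversalEnvelopingAlgebra.hom_ext
    refine LieHom.ext fun X => ?_
    simp only [LieHom.coe_comp, Function.comp_apply, AlgHom.coe_toLieHom, AlgHom.coe_comp,
      Subalgebra.coe_val, AlgHom.coe_id, id_eq, lift_ι_apply]
    rfl
  refine eq_top_iff.2 fun u _ => ?_
  have hu : u = S.val (lift R f u) := by rw [← AlgHom.comp_apply, hg, AlgHom.coe_id, id_eq]
  rw [hu]
  exact (lift R f u).2

/-- **Induction on `U(𝔥)`**: a property holding on the generators `ι X` and on the scalars, and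
stable under sums and products, holds everywhere. [folklore] -/
theorem envelope_induction {P : UniversalEnvelopingAlgebra R L → Prop} (hι : ∀ X : L, P (ι R X))
    (halg : ∀ r : R, P (algebraMap R (UniversalEnvelopingAlgebra R L) r))
    (hadd : ∀ a b, P a → P b → P (a + b))
    (hmul : ∀ a b, P a → P b → P (a * b)) (u : UniversalEnvelopingAlgebra R L) : P u := by
  let S : Subalgebra R (UniversalEnvelopingAlgebra R L) :=
    { carrier := {u | P u}
      mul_mem' := fun {a b} ha hb => hmul a b ha hb
      add_mem' := fun {a b} ha hb => hadd a b ha hb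
      algebraMap_mem' := halg }
  have hS := envelope_subalgebra_eq_top_of_forall_ι_mem S hι
  have hu : u ∈ S := hS ▸ Algebra.mem_top
  exact hu

/-- **A central element of `𝔥` is central in `U(𝔥)`** (it commutes with the generators).
[folklore] -/
theorem envelope_ι_mem_center_of_forall_lie_eq_zero {Z : L} (hZ : ∀ Y : L, ⁅Z, Y⁆ = 0) :
    ι R Z ∈ Subalgebra.center R (UniversalEnvelopingAlgebra R L) := by
  rw [Subalgebra.mem_center_iff]
  intro u
  refine envelope_induction (P := fun u => u * ι R Z = ι R Z * u) (fun Y => ?_) (fun r => ?_)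
    (fun a b ha hb => ?_) (fun a b ha hb => ?_) u
  · have h := (LieHom.map_lie (ι R) Z Y).symm
    rw [hZ, map_zero, LieRing.of_associative_ring_bracket, sub_eq_zero] at h
    exact h.symm
  · exact Algebra.commutes (A := UniversalEnvelopingAlgebra R L) r (ι R Z)
  · rw [add_mul, mul_add, ha, hb]
  · rw [mul_assoc, hb, ← mul_assoc, ha, mul_assoc]

end Envelope

/-! ### Intertwining operators commute with the whole action of `U(𝔥)` -/

section Intertwine

variable {L : Type*} [LieRing L] [LieAlgebra ℝ L] {V W : Type*} [AddCommGroup V] [Module ℂ V]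
  [AddCommGroup W] [Module ℂ W]

/-- **A linear map intertwining two Lie algebra actions intertwines the enveloping algebra
actions**: if `q (ρ_V X v) = ρ_W X (q v)` for all `X ∈ 𝔥`, then
`q (lift ρ_V u v) = lift ρ_W u (q v)` for all `u ∈ U(𝔥)` (induction on `u`). Dixmier, 2.2.
[folklore] -/
theorem lift_apply_intertwine (ρV : L →ₗ⁅ℝ⁆ Module.End ℂ V) (ρW : L →ₗ⁅ℝ⁆ Module.End ℂ W)
    (q : V →ₗ[ℂ] W) (h : ∀ (X : L) (v : V), ρW X (q v) = q (ρV X v))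
    (u : UniversalEnvelopingAlgebra ℝ L) (v : V) :
    lift ℝ ρW u (q v) = q (lift ℝ ρV u v) := by
  revert v
  refine envelope_induction (P := fun u => ∀ v : V, lift ℝ ρW u (q v) = q (lift ℝ ρV u v))
    (fun X v => ?_) (fun r v => ?_) (fun a b ha hb v => ?_) (fun a b ha hb v => ?_) u
  · rw [lift_ι_apply, lift_ι_apply]
    exact h X v
  · rw [AlgHom.commutes, AlgHom.commutes, Module.algebraMap_end_apply, Module.algebraMap_end_apply,
      LinearMap.map_smul_of_tower]
  · rw [map_add, map_add, LinearMap.add_apply, LinearMap.add_apply, ha, hb, q.map_add]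
  · rw [map_mul, map_mul, Module.End.mul_apply, Module.End.mul_apply, hb, ha]

/-- **An operator commuting with `ρ(𝔥)` commutes with `ρ(U(𝔥))`.** [folklore] -/
theorem commute_lift_of_forall_commute (ρ : L →ₗ⁅ℝ⁆ Module.End ℂ V) (T : Module.End ℂ V)
    (h : ∀ X : L, Commute T (ρ X)) (u : UniversalEnvelopingAlgebra ℝ L) : Commute T (lift ℝ ρ u) :=
  LinearMap.ext fun v =>
    (lift_apply_intertwine ρ ρ T (fun X v => (LinearMap.congr_fun (h X).eq v).symm) u v).symm

end Intertwine

/-! ### `U(𝔥)` acting on `W` and on `W / W'` of an automorphic representation datum -/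

namespace AutomorphicRepData

variable {n : ℕ} {K : Type} [Field K] [NumberField K] {hcpt : isCompact_glFiniteIntegralLevel n K}
  {H : Type*} [LieRing H] [LieAlgebra ℝ H] (f : H →ₗ⁅ℝ⁆ (AutomorphyDatum.gl n K hcpt).arch.lie)

/-- **`U(𝔥)` acts on `W / W'` through its action on `W`**: for every `u ∈ U(𝔥)` and `w ∈ W`,
`(lift (π.lieRep ∘ f) u) [w] = [(lift (π.lieRepW ∘ f) u) w]` (on generators: `lieRep_mkQ`).
Borel–Jacquet 1979, 4.6. [folklore] -/
theorem lift_lieRep_comp_mkQ (π : AutomorphicRepData (AutomorphyDatum.gl n K hcpt))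
    (u : UniversalEnvelopingAlgebra ℝ H) (w : π.W) :
    lift ℝ (π.lieRep.comp f) u (π.mkQ w) = π.mkQ (lift ℝ (π.lieRepW.comp f) u w) :=
  lift_apply_intertwine (π.lieRepW.comp f) (π.lieRep.comp f) π.mkQ
    (fun X w => π.lieRep_mkQ (f X) w) u w

/-- **Restriction to sub-data**: if `π₀.W ≤ π.W` then `U(𝔥)` acts on `π₀.W` by the restriction of
its action on `π.W` (on generators both are the Lie derivative `X φ`). [folklore] -/
theorem inclusion_lift_lieRepW {π₀ π : AutomorphicRepData (AutomorphyDatum.gl n K hcpt)}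
    (h : π₀.W ≤ π.W) (u : UniversalEnvelopingAlgebra ℝ H) (c : π₀.W) :
    Submodule.inclusion h (lift ℝ (π₀.lieRepW.comp f) u c) =
      lift ℝ (π.lieRepW.comp f) u (Submodule.inclusion h c) :=
  (lift_apply_intertwine (π₀.lieRepW.comp f) (π.lieRepW.comp f) (Submodule.inclusion h)
    (fun _ _ => Subtype.ext rfl) u c).symm

/-- The same on functions: the operators of `U(𝔥)` on `π₀.W ≤ π.W` are those on `π.W`.
[folklore] -/
theorem coe_lift_lieRepW_of_le {π₀ π : AutomorphicRepData (AutomorphyDatum.gl n K hcpt)}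
    (h : π₀.W ≤ π.W) (u : UniversalEnvelopingAlgebra ℝ H) (c : π₀.W) :
    ((lift ℝ (π₀.lieRepW.comp f) u c : π₀.W) : (AdelicGroupData.gl n K).Adelic → ℂ) =
      ((lift ℝ (π.lieRepW.comp f) u (Submodule.inclusion h c) : π.W) :
        (AdelicGroupData.gl n K).Adelic → ℂ) := by
  rw [← inclusion_lift_lieRepW f h u c]
  rfl

/-- **Central elements of `𝔤` act by operators commuting with `U(𝔥)`**: if `⁅Z, Y⁆ = 0` for all
`Y ∈ 𝔤` (e.g. `Z = 1`, the generator of `A_G`, `lie_one_eq_zero`), then `π.lieRepW Z` commutes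
with `lift (π.lieRepW ∘ f) u` for every `u ∈ U(𝔥)`. [folklore] -/
theorem commute_lieRepW_of_forall_lie_eq_zero (π : AutomorphicRepData (AutomorphyDatum.gl n K hcpt))
    {Z : (AutomorphyDatum.gl n K hcpt).arch.lie}
    (hZ : ∀ Y : (AutomorphyDatum.gl n K hcpt).arch.lie, ⁅Z, Y⁆ = 0)
    (u : UniversalEnvelopingAlgebra ℝ H) :
    Commute (π.lieRepW Z) (lift ℝ (π.lieRepW.comp f) u) := by
  refine commute_lift_of_forall_commute _ _ (fun X => ?_) u
  have h := (LieHom.map_lie π.lieRepW Z (f X)).symm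
  rw [hZ, map_zero, LieRing.of_associative_ring_bracket, sub_eq_zero] at h
  exact h

end AutomorphicRepData

end Literature.NumberTheory.Automorphic
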